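import Summits.NavierStokesRegularity.FunctionalMining.BiaxialXRay
import HarnessLib

/-!
# FunctionalMining — X-RAY CONSTRAINTS ON RATIONAL 2-TORI: the mixed strain `aᵀ S(v) b` integrates to zero
# over every closed 2-torus spanned by lattice vectors `a, b`; for a biaxial strain `⟨(a·n)(b·n)⟩ = (a·b)/3`

Search for candidate a priori estimates; no regularity claim. Cell `pub-nsfunc`, prove seat (gen 20).
Static calculus of smooth fields on the flat torus; nothing about Navier–Stokes dynamics. Completes the
"X-ray constraints" remark of `SIEVELD.md` §3.4b (4b) ("… and `⟨n_a n_b⟩ = δ_ab/3` on every rational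
2-torus"), after the closed-line half in `BiaxialXRay`.

* `hasDerivAt_weighted_line`: `d/dt (W·v)(x + tK) = ∑ᵢⱼ WᵢKⱼ∂ⱼvᵢ(x + tK)`; for a lattice `K` the integral of
  the right side over `t ∈ [0,1]` vanishes (`intervalIntegral_weighted_eq_zero`).
* `intervalIntegral_swap_continuous`: Fubini for a continuous integrand on `[0,1]²` (Mathlib
  `integral_integral_swap` on `Ioc 0 1 × Ioc 0 1`).
* **`intervalIntegral₂_mixedStrain_eq_zero`**: for lattice vectors `a, b` and every `x`,
  `∫₀¹∫₀¹ aᵀ S(v)(x + sa + tb) b dt ds = 0` — since `aᵀSb = ½[∂_b(a·v) + ∂_a(b·v)]` and each half is a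
  derivative along a closed line of the 2-torus.
* **`intervalIntegral₂_axis_mixed`** (biaxial, fully three-dimensional axis): if `S(v) = m(1 − 3n⊗n)`,
  `m ≠ 0`, then `∫₀¹∫₀¹ (a·n)(b·n)(x + sa + tb) dt ds = (a·b)/3`; `a = b` recovers the line constraint,
  `a ⊥ b` gives `⟨(a·n)(b·n)⟩ = 0` (coordinate 2-tori: `⟨nᵢnⱼ⟩ = δᵢⱼ/3`, `intervalIntegral₂_axis_coord`).
[ours = assembly; folklore = line calculus + Fubini]
-/

noncomputable section

open MeasureTheory Set Filter Topology intervalIntegral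

namespace Summit.NavierStokesRegularity.FunctionalMining
open Literature.Analysis Literature.Analysis.FunctionSpaces Literature.Analysis.FunctionSpaces.Torus
  Literature.Analysis.FluidPDE

namespace BiaxialEikonal

variable {d : Type*} [Fintype d] [DecidableEq d]

/-! ## 1. Weighted line derivatives and Fubini on the unit square -/

/-- `d/dt (W·v)(x + tK) = ∑ᵢⱼ Wᵢ Kⱼ ∂ⱼvᵢ(x + tK)`. [folklore] -/
theorem hasDerivAt_weighted_line {v : UnitAddTorus d → EuclideanSpace ℝ d} (hv : Torus.IsSmooth v)
    (x : UnitAddTorus d) (W K : EuclideanSpace ℝ d) (t : ℝ) :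
    HasDerivAt (fun s : ℝ => ∑ i, W i * v (x + proj (s • K)) i)
      (∑ i, ∑ j, W i * K j * Torus.partialDeriv j v (x + proj (t • K)) i) t := by
  have hline := hasDerivAt_line hv x K t
  have hcoord : ∀ i, HasDerivAt (fun s : ℝ => v (x + proj (s • K)) i)
      (Torus.fderiv v (x + proj (t • K)) K i) t := fun i =>
    (EuclideanSpace.proj i : EuclideanSpace ℝ d →L[ℝ] ℝ).hasFDerivAt.comp_hasDerivAt t hline
  have hsum : HasDerivAt (fun s : ℝ => ∑ i, W i * v (x + proj (s • K)) i)
      (∑ i, W i * Torus.fderiv v (x + proj (t • K)) K i) t :=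
    HasDerivAt.fun_sum fun i _ => (hcoord i).const_mul (W i)
  have hval : ∀ i, Torus.fderiv v (x + proj (t • K)) K i =
      ∑ j, K j * Torus.partialDeriv j v (x + proj (t • K)) i := by
    intro i
    rw [fderiv_apply_eq_sum_partialDeriv (hv.isContDiff (by simp))]
    simp [Finset.sum_apply]
  refine hsum.congr_deriv (Finset.sum_congr rfl fun i _ => ?_)
  rw [hval i, Finset.mul_sum]
  exact Finset.sum_congr rfl fun j _ => by ring

/-- Joint continuity of the weighted partials along a two-parameter family of translates. [folklore] -/
theorem continuous_weighted_partials₂ {v : UnitAddTorus d → EuclideanSpace ℝ d} (hv : Torus.IsSmooth v)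
    (x : UnitAddTorus d) (W K A B : EuclideanSpace ℝ d) :
    Continuous (Function.uncurry fun s t : ℝ =>
      ∑ i, ∑ j, W i * K j * Torus.partialDeriv j v (x + proj (s • A + t • B)) i) := by
  have hpath : Continuous fun p : ℝ × ℝ => x + proj (p.1 • A + p.2 • B) :=
    continuous_const.add (continuous_proj.comp
      ((continuous_fst.smul continuous_const).add (continuous_snd.smul continuous_const)))
  refine continuous_finsetSum _ fun i _ => continuous_finsetSum _ fun j _ =>
    continuous_const.mul ?_
  exact ((hv.partialDeriv j).apply i).continuous.comp hpath

/-- Along a closed lattice line the weighted derivative integrates to zero: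
`∫₀¹ ∑ᵢⱼ Wᵢkⱼ∂ⱼvᵢ(x + tk) dt = W·v(x + k) − W·v(x) = 0`. [folklore] -/
theorem intervalIntegral_weighted_eq_zero {v : UnitAddTorus d → EuclideanSpace ℝ d} (hv : Torus.IsSmooth v)
    (W : EuclideanSpace ℝ d) (k : d → ℤ) (x : UnitAddTorus d) :
    ∫ t in (0 : ℝ)..1, ∑ i, ∑ j, W i * (latticeVec k) j *
      Torus.partialDeriv j v (x + proj (t • latticeVec k)) i = 0 := by
  set K := latticeVec k with hK
  have hcont : Continuous fun t : ℝ => ∑ i, ∑ j, W i * K j * Torus.partialDeriv j v (x + proj (t • K)) i := by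
    have h := continuous_weighted_partials₂ hv x W K 0 K
    have : (fun t : ℝ => ∑ i, ∑ j, W i * K j * Torus.partialDeriv j v (x + proj (t • K)) i) =
        (Function.uncurry fun s t : ℝ => ∑ i, ∑ j, W i * K j *
          Torus.partialDeriv j v (x + proj (s • (0 : EuclideanSpace ℝ d) + t • K)) i) ∘ fun t => ((0 : ℝ), t) := by
      funext t; simp
    rw [this]
    exact h.comp (continuous_const.prodMk continuous_id)
  rw [integral_eq_sub_of_hasDerivAt (fun t _ => hasDerivAt_weighted_line hv x W K t) (hcont.intervalIntegrable _ _)]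
  simp [hK, proj_latticeVec]

/-- **Fubini on the unit square for a continuous integrand.** [folklore] -/
theorem intervalIntegral_swap_continuous {f : ℝ → ℝ → ℝ} (hf : Continuous (Function.uncurry f)) :
    ∫ s in (0 : ℝ)..1, ∫ t in (0 : ℝ)..1, f s t = ∫ t in (0 : ℝ)..1, ∫ s in (0 : ℝ)..1, f s t := by
  simp only [intervalIntegral.integral_of_le zero_le_one]
  have hint : Integrable (Function.uncurry f)
      ((volume.restrict (Ioc (0 : ℝ) 1)).prod (volume.restrict (Ioc (0 : ℝ) 1))) := by
    rw [Measure.prod_restrict]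
    have hK : IsCompact (Icc (0 : ℝ) 1 ×ˢ Icc (0 : ℝ) 1) := isCompact_Icc.prod isCompact_Icc
    have h1 : IntegrableOn (Function.uncurry f) (Icc (0 : ℝ) 1 ×ˢ Icc (0 : ℝ) 1)
        ((volume : Measure ℝ).prod volume) := hf.continuousOn.integrableOn_compact hK
    exact h1.mono_set (Set.prod_mono Ioc_subset_Icc_self Ioc_subset_Icc_self)
  exact integral_integral_swap hint

/-! ## 2. The mixed strain integrates to zero over every rational 2-torus -/

/-- Splitting of the mixed strain form: `∑ᵢⱼ AᵢBⱼ Sᵢⱼ = ½(∑ᵢⱼ AᵢBⱼ∂ⱼvᵢ + ∑ᵢⱼ BᵢAⱼ∂ⱼvᵢ)`. [folklore] -/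
theorem mixedStrain_split (v : UnitAddTorus d → EuclideanSpace ℝ d) (y : UnitAddTorus d)
    (A B : EuclideanSpace ℝ d) :
    ∑ i, ∑ j, A i * B j * torusStrainMatrix v y i j =
      (∑ i, ∑ j, A i * B j * Torus.partialDeriv j v y i + ∑ i, ∑ j, B i * A j * Torus.partialDeriv j v y i) / 2 := by
  simp only [torusStrainMatrix_apply]
  have h2 : ∑ i, ∑ j, B i * A j * Torus.partialDeriv j v y i = ∑ i, ∑ j, A i * B j * Torus.partialDeriv i v y j := by
    rw [Finset.sum_comm]
    exact Finset.sum_congr rfl fun i _ => Finset.sum_congr rfl fun j _ => by ring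
  rw [h2, add_div, Finset.sum_div, Finset.sum_div, ← Finset.sum_add_distrib]
  refine Finset.sum_congr rfl fun i _ => ?_
  rw [Finset.sum_div, Finset.sum_div, ← Finset.sum_add_distrib]
  exact Finset.sum_congr rfl fun j _ => by ring

/-- **X-RAY CONSTRAINT ON RATIONAL 2-TORI.** For a smooth field `v` on `T^d`, lattice vectors `a, b` and
every base point `x`: `∫₀¹∫₀¹ aᵀ S(v)(x + sa + tb) b dt ds = 0`. [folklore] -/
theorem intervalIntegral₂_mixedStrain_eq_zero {v : UnitAddTorus d → EuclideanSpace ℝ d}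
    (hv : Torus.IsSmooth v) (a b : d → ℤ) (x : UnitAddTorus d) :
    ∫ s in (0 : ℝ)..1, ∫ t in (0 : ℝ)..1, ∑ i, ∑ j, (latticeVec a) i * (latticeVec b) j *
      torusStrainMatrix v (x + proj (s • latticeVec a + t • latticeVec b)) i j = 0 := by
  set A := latticeVec a with hA
  set B := latticeVec b with hB
  -- the two halves
  set P : ℝ → ℝ → ℝ := fun s t => ∑ i, ∑ j, A i * B j *
    Torus.partialDeriv j v (x + proj (s • A + t • B)) i with hP
  set Q : ℝ → ℝ → ℝ := fun s t => ∑ i, ∑ j, B i * A j *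
    Torus.partialDeriv j v (x + proj (s • A + t • B)) i with hQ
  have hsplit : ∀ s t, ∑ i, ∑ j, A i * B j * torusStrainMatrix v (x + proj (s • A + t • B)) i j =
      P s t / 2 + Q s t / 2 := fun s t => by
    rw [mixedStrain_split, hP, hQ, add_div]
  simp_rw [hsplit]
  have hPc : Continuous (Function.uncurry P) := continuous_weighted_partials₂ hv x A B A B
  have hQc : Continuous (Function.uncurry Q) := continuous_weighted_partials₂ hv x B A A B
  -- inner `t`-integral of `P` vanishes for every `s` (closed `b`-line through `x + sa`)
  have hP0 : ∀ s : ℝ, ∫ t in (0 : ℝ)..1, P s t = 0 := by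
    intro s
    have h := intervalIntegral_weighted_eq_zero hv A b (x + proj (s • A))
    rw [← hB] at h
    have e : ∀ t : ℝ, x + proj (s • A) + proj (t • B) = x + proj (s • A + t • B) := fun t => by
      rw [proj_add, add_assoc]
    simp_rw [e] at h
    exact h
  -- inner `s`-integral of `Q` vanishes for every `t` (closed `a`-line through `x + tb`)
  have hQ0 : ∀ t : ℝ, ∫ s in (0 : ℝ)..1, Q s t = 0 := by
    intro t
    have h := intervalIntegral_weighted_eq_zero hv B a (x + proj (t • B))
    rw [← hA] at h
    have e : ∀ s : ℝ, x + proj (t • B) + proj (s • A) = x + proj (s • A + t • B) := fun s => by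
      rw [proj_add, add_assoc, add_comm (proj (t • B))]
    simp_rw [e] at h
    exact h
  have hPi : ∀ s : ℝ, IntervalIntegrable (fun t => P s t / 2) volume 0 1 := fun s =>
    ((hPc.comp (continuous_const.prodMk continuous_id)).div_const 2).intervalIntegrable _ _
  have hQi : ∀ s : ℝ, IntervalIntegrable (fun t => Q s t / 2) volume 0 1 := fun s =>
    ((hQc.comp (continuous_const.prodMk continuous_id)).div_const 2).intervalIntegrable _ _
  have hinner : ∀ s : ℝ, ∫ t in (0 : ℝ)..1, (P s t / 2 + Q s t / 2) = (∫ t in (0 : ℝ)..1, Q s t) / 2 := by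
    intro s
    rw [intervalIntegral.integral_add (hPi s) (hQi s), intervalIntegral.integral_div,
      intervalIntegral.integral_div, hP0 s]
    ring
  simp_rw [hinner]
  rw [intervalIntegral.integral_div, intervalIntegral_swap_continuous hQc]
  simp [hQ0]

/-! ## 3. Biaxial axes: `⟨(a·n)(b·n)⟩ = (a·b)/3` on every rational 2-torus -/

/-- The mixed form of a biaxial matrix: `aᵀ·m(1 − 3n⊗n)·b = m(a·b − 3(a·n)(b·n))`. [ours] -/
theorem mixed_biaxial (m : ℝ) (n A B : d → ℝ) :
    ∑ i, ∑ j, A i * B j * (m • (1 - (3 : ℝ) • Matrix.vecMulVec n n) : Matrix d d ℝ) i j =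
      m * (∑ i, A i * B i - 3 * ((∑ i, A i * n i) * ∑ i, B i * n i)) := by
  simp only [Matrix.smul_apply, Matrix.sub_apply, Matrix.one_apply, Matrix.vecMulVec_apply, smul_eq_mul]
  have h1 : ∑ i, ∑ j, A i * B j * (m * ((if i = j then 1 else 0) - 3 * (n i * n j))) =
      m * ∑ i, ∑ j, (A i * B j * (if i = j then 1 else 0) - 3 * (A i * n i * (B j * n j))) := by
    rw [Finset.mul_sum]
    refine Finset.sum_congr rfl fun i _ => ?_
    rw [Finset.mul_sum]
    exact Finset.sum_congr rfl fun j _ => by ring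
  rw [h1]
  congr 1
  simp only [Finset.sum_sub_distrib, mul_ite, mul_one, mul_zero, Finset.sum_ite_eq, Finset.mem_univ,
    if_true, ← Finset.mul_sum, ← Finset.sum_mul]

/-- **X-RAY CONSTRAINT ON THE AXIS OVER RATIONAL 2-TORI** (fully three-dimensional axis): if
`S(v)(y) = m(1 − 3 n(y)⊗n(y))` with `m ≠ 0`, then for lattice vectors `a, b` and every `x`,
`∫₀¹∫₀¹ (a·n)(b·n)(x + sa + tb) dt ds = (a·b)/3` (no measurability of `n` assumed: the integrand is
`((a·b) − aᵀSb/m)/3`, continuous). [ours; SIEVELD §3.4b (4b) "⟨n_a n_b⟩ = δ_ab/3 on every rational 2-torus"] -/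
theorem intervalIntegral₂_axis_mixed {v : UnitAddTorus d → EuclideanSpace ℝ d} (hv : Torus.IsSmooth v)
    {m : ℝ} (hm : m ≠ 0) {n : UnitAddTorus d → d → ℝ}
    (hS : ∀ y, torusStrainMatrix v y = m • (1 - (3 : ℝ) • Matrix.vecMulVec (n y) (n y)))
    (a b : d → ℤ) (x : UnitAddTorus d) :
    ∫ s in (0 : ℝ)..1, ∫ t in (0 : ℝ)..1,
      (∑ i, (latticeVec a) i * n (x + proj (s • latticeVec a + t • latticeVec b)) i) *
        (∑ i, (latticeVec b) i * n (x + proj (s • latticeVec a + t • latticeVec b)) i) =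
      (∑ i, (latticeVec a) i * (latticeVec b) i) / 3 := by
  set A := latticeVec a with hA
  set B := latticeVec b with hB
  set L : ℝ → ℝ → ℝ := fun s t => ∑ i, ∑ j, A i * B j *
    torusStrainMatrix v (x + proj (s • A + t • B)) i j with hL
  have hLst : ∀ s t : ℝ, L s t = m * (∑ i, A i * B i -
      3 * ((∑ i, A i * n (x + proj (s • A + t • B)) i) * ∑ i, B i * n (x + proj (s • A + t • B)) i)) := by
    intro s t
    rw [hL]
    simp only [hS]
    exact mixed_biaxial m _ A B
  have hrepr : ∀ s t : ℝ, (∑ i, A i * n (x + proj (s • A + t • B)) i) * (∑ i, B i * n (x + proj (s • A + t • B)) i) =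
      ((∑ i, A i * B i) - L s t / m) / 3 := by
    intro s t
    rw [hLst s t]
    field_simp
    ring
  simp_rw [hrepr]
  -- continuity of `L` (through its strain expression)
  have hLc : Continuous (Function.uncurry L) := by
    have hsplit : Function.uncurry L = fun p : ℝ × ℝ =>
        ((∑ i, ∑ j, A i * B j * Torus.partialDeriv j v (x + proj (p.1 • A + p.2 • B)) i) +
          ∑ i, ∑ j, B i * A j * Torus.partialDeriv j v (x + proj (p.1 • A + p.2 • B)) i) / 2 := by
      funext p
      simp only [Function.uncurry, hL]
      exact mixedStrain_split v _ A B
    rw [hsplit]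
    exact ((continuous_weighted_partials₂ hv x A B A B).add (continuous_weighted_partials₂ hv x B A A B)).div_const 2
  have hX : ∫ s in (0 : ℝ)..1, ∫ t in (0 : ℝ)..1, L s t = 0 := intervalIntegral₂_mixedStrain_eq_zero hv a b x
  have hLi : ∀ s : ℝ, IntervalIntegrable (fun t => L s t) volume 0 1 := fun s =>
    (hLc.comp (continuous_const.prodMk continuous_id)).intervalIntegrable _ _
  have hinner : ∀ s : ℝ, ∫ t in (0 : ℝ)..1, ((∑ i, A i * B i) - L s t / m) / 3 =
      ((∑ i, A i * B i) - (∫ t in (0 : ℝ)..1, L s t) / m) / 3 := by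
    intro s
    rw [intervalIntegral.integral_div, intervalIntegral.integral_sub intervalIntegrable_const ((hLi s).div_const m),
      intervalIntegral.integral_const, intervalIntegral.integral_div]
    simp
  simp_rw [hinner]
  -- outer integral: the map `s ↦ ∫ₜ L s t` is continuous (parametric integral of a continuous function)
  have hIc : Continuous fun s => ∫ t in (0 : ℝ)..1, L s t :=
    intervalIntegral.continuous_parametric_intervalIntegral_of_continuous' hLc 0 1
  have hIi : IntervalIntegrable (fun s => ∫ t in (0 : ℝ)..1, L s t) volume 0 1 := hIc.intervalIntegrable _ _
  rw [intervalIntegral.integral_div, intervalIntegral.integral_sub intervalIntegrable_const (hIi.div_const m),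
    intervalIntegral.integral_const, intervalIntegral.integral_div, hX]
  simp

/-- Coordinate 2-tori: for `i ≠ j`, `∫₀¹∫₀¹ nᵢ nⱼ (x + s eᵢ + t eⱼ) dt ds = 0`, and for `i = j` (a doubly
traversed circle) the value is `1/3`. [ours] -/
theorem intervalIntegral₂_axis_coord {v : UnitAddTorus d → EuclideanSpace ℝ d} (hv : Torus.IsSmooth v)
    {m : ℝ} (hm : m ≠ 0) {n : UnitAddTorus d → d → ℝ}
    (hS : ∀ y, torusStrainMatrix v y = m • (1 - (3 : ℝ) • Matrix.vecMulVec (n y) (n y)))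
    (i j : d) (x : UnitAddTorus d) :
    ∫ s in (0 : ℝ)..1, ∫ t in (0 : ℝ)..1,
      n (x + proj (s • EuclideanSpace.single i (1 : ℝ) + t • EuclideanSpace.single j (1 : ℝ))) i *
        n (x + proj (s • EuclideanSpace.single i (1 : ℝ) + t • EuclideanSpace.single j (1 : ℝ))) j =
      (if i = j then 1 else 0) / 3 := by
  have h := intervalIntegral₂_axis_mixed hv hm hS (Pi.single i 1) (Pi.single j 1) x
  rw [latticeVec_single, latticeVec_single] at h
  simpa [PiLp.single_apply, Pi.single_apply, Finset.sum_ite_eq', Finset.mem_univ, eq_comm] using h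

end BiaxialEikonal

end Summit.NavierStokesRegularity.FunctionalMining

end
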